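import Mathlib
import Summits.ResolutionOfSingularities.ResolutionOfSingularities.Theorems.WeightedInvariantFormallySmoothResidueBinomial
import HarnessLib

/-!
# Residue fields along essentially smooth local maps, (F4): a `κ`-rational binomial row with a POLYNOMIAL root has a
# `κ`-rational root (door `HypersurfaceCentreConstruction`, stmt-ResolutionOfSingularities-19897; P3 rung clause (c11)≤3,
# ORDER (o53) PART 6 = GAP 1′ «the terminal contact level descends at dimension three», hand res-L1-w43-stub-3)

Topic: `Summits/ResolutionOfSingularities/ResolutionOfSingularities/Theorems`. Helper for the door item
`HypersurfaceCentreConstruction` (stmt-ResolutionOfSingularities-19897, route `WeightedInvariant`), line `local-engine`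
(L W4.3), def-free.  res-type-070's (F1) `FormallySmoothField.exists_algebraMap_eq_of_binomial_face` (p52xxxx,
`…FormallySmoothResidueBinomial`) is the residue-field lemma of the DIMENSION-TWO descent of contact levels: the level-`b` face
of `f` in coordinates `(x, y)` is a row of SCALARS `a_j`, and a binomial row `c · C(ν,j) · t^{ν-j}` over the (separable) residue
extension `K / κ` has `t ∈ κ`.  In dimension `d ≥ 3` the face coefficients are FORMS of degree `b(ν-j)` in `x₁, …, x_{d-1}` and
the root is a form `R` of degree `b`; dehomogenised (dimension three: binary forms ↔ polynomials of degree `≤ b`), the row is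
`c · C(ν,j) · R^{ν-j}` with `R ∈ K[X]`.  THIS FILE proves the polynomial version (MEMO `L/res-L1-w43-stub-3/g5/O53-MEMO.md`,
PART 6a docstring «GAP 1″»):

* `natCast_choose_pow_mul_pred` — `C(p^e m, p^e (m-1)) = m` in characteristic `p` (the coefficient of `(X + 1)^{p^e m}` at
  `X^{p^e (m-1)}` read directly and through `(X + 1)^{p^e m} = expand_{p^e} ((X + 1)^m)`; no Lucas theorem needed).
* `exists_map_eq_of_pow_eq_map` — over a formally smooth, essentially-of-finite-type (= separable) field extension `K / κ` of
  characteristic `p`: `R^{p^e} ∈ κ[X] ⇒ R ∈ κ[X]` (coefficientwise: `(R^{p^e})_{i p^e} = R_i^{p^e}` by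
  `Polynomial.map_iterateFrobenius_expand`, then res-type-078's `exists_pow_pow_eq_of_formallySmooth` and injectivity of Frobenius).
* **`exists_map_eq_of_binomial_face_polynomial`** — `K / κ` formally smooth and essentially of finite type, `ν ≥ 1`, `c ≠ 0`,
  `R ∈ K[X]`; if every `c · C(ν, j) · R^{ν-j}` (`j ≤ ν`) is the image of a polynomial `A_j ∈ κ[X]`, then `R` is the image of a
  polynomial of `κ[X]` (characteristic `0`: `R = A_{ν-1} / (ν c)`; characteristic `p`, `ν = p^e m`, `p ∤ m`:
  `R^{p^e} = A_{p^e(m-1)} / (m c)` and the previous lemma).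

[OURS · L1 W4.3 · (o53)]  Replaces the role of NO printed item; NOT a statement of the manuscript
[claim: Hironaka2017, status: under-review]. AI work, weaker than expert review.  Pure field theory; no named facts.

## References

* A. Grothendieck, EGA 0_IV 19.6.1 (formally smooth = separable field extensions). [folklore]
* H. Matsumura, *Commutative Ring Theory* (1987), Thm. 26.9. [Matsumura1987]
-/

noncomputable section

open Polynomial

set_option linter.dupNamespace false -- mandated namespace of this single-conjunct summit

namespace Summit.ResolutionOfSingularities.ResolutionOfSingularities.Theorems

namespace FormallySmoothField

/-! ### A binomial coefficient in characteristic `p` -/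

/-- **`C(p^e m, p^e (m-1)) = m` in a ring of exponential characteristic `p`** (`m ≥ 1`): both sides are the coefficient of
`X^{p^e (m-1)}` in `(X + 1)^{p^e m} = expand_{p^e} ((X + 1)^m)`. [folklore] -/
theorem natCast_choose_pow_mul_pred (K : Type) [CommRing K] (p : ℕ) [ExpChar K p] (e : ℕ) {m : ℕ} (hm : 1 ≤ m) :
    (((p ^ e * m).choose (p ^ e * (m - 1)) : ℕ) : K) = m := by
  have hpe : 0 < p ^ e := pow_pos (expChar_pos K p) e
  have hexp : (X + C 1 : K[X]) ^ (p ^ e * m) = expand K (p ^ e) ((X + C 1) ^ m) := by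
    rw [pow_mul, add_pow_expChar_pow, map_pow, map_add, expand_X, expand_C, ← C_pow, one_pow]
  have h1 : ((X + C 1 : K[X]) ^ (p ^ e * m)).coeff (p ^ e * (m - 1)) = (((p ^ e * m).choose (p ^ e * (m - 1)) : ℕ) : K) := by
    rw [coeff_X_add_C_pow, one_pow, one_mul]
  have h2 : ((X + C 1 : K[X]) ^ (p ^ e * m)).coeff (p ^ e * (m - 1)) = (m : K) := by
    rw [hexp, coeff_expand_mul' hpe, coeff_X_add_C_pow, one_pow, one_mul,
      Nat.choose_symm_of_eq_add (by omega : m = (m - 1) + 1), Nat.choose_one_right]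
  rw [← h1, h2]

/-! ### `p^e`-th roots of rational polynomials are rational over a separable extension -/

/-- **Over a formally smooth, essentially-of-finite-type field extension `K / κ` of characteristic `p`, a polynomial whose
`p^e`-th power is `κ`-rational is `κ`-rational**: `R^{p^e} = Q` with `Q ∈ κ[X]` ⇒ `R ∈ κ[X]`.  Coefficientwise
`R_i^{p^e} = Q_{i p^e}` (`Polynomial.map_iterateFrobenius_expand`); `Q_{i p^e}` is then a `p^e`-th power in `κ` by separability
(res-type-078's `exists_pow_pow_eq_of_formallySmooth`), and Frobenius is injective. [cite: Matsumura1987, Thm. 26.9] -/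
theorem exists_map_eq_of_pow_eq_map (κ K : Type) [Field κ] [Field K] [Algebra κ K] [Algebra.FormallySmooth κ K]
    [Algebra.EssFiniteType κ K] (p : ℕ) [Fact p.Prime] [CharP κ p] (e : ℕ) {Q : κ[X]} {R : K[X]}
    (h : R ^ p ^ e = Q.map (algebraMap κ K)) : ∃ R₀ : κ[X], R₀.map (algebraMap κ K) = R := by
  haveI : CharP K p := charP_of_injective_algebraMap (algebraMap κ K).injective p
  haveI : ExpChar K p := ExpChar.prime (Fact.out : p.Prime)
  have hpe : 0 < p ^ e := pow_pos (Fact.out : p.Prime).pos e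
  have hcoeff : ∀ i : ℕ, (R.coeff i) ^ p ^ e = algebraMap κ K (Q.coeff (i * p ^ e)) := by
    intro i
    have h1 := congrArg (fun P : K[X] => P.coeff (i * p ^ e)) (map_iterateFrobenius_expand p R e)
    simp only [coeff_map, coeff_expand_mul hpe, iterateFrobenius_def] at h1
    rw [h1, h, coeff_map]
  rw [← mem_lifts, lifts_iff_coeff_lifts]
  intro i
  obtain ⟨μ, hμ⟩ := exists_pow_pow_eq_of_formallySmooth κ K p e (hcoeff i)
  refine ⟨μ, ?_⟩
  have h0 : (algebraMap κ K μ - R.coeff i) ^ p ^ e = 0 := by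
    rw [sub_pow_expChar_pow, ← map_pow, hμ, ← hcoeff i, sub_self]
  exact sub_eq_zero.mp ((pow_eq_zero_iff hpe.ne').mp h0)

/-! ### (F4) A rational binomial row with a polynomial root has a rational root -/

/-- **(F4) A `κ`-rational binomial row with a POLYNOMIAL root over a separable extension has a `κ`-rational root.**  For a field
extension `K / κ` that is formally smooth and essentially of finite type, `ν ≥ 1`, `c ≠ 0` and `R ∈ K[X]`: if every
`c · C(ν, j) · R^{ν-j}` (`j ≤ ν`) is the image of some `A_j ∈ κ[X]`, then `R` is the image of a polynomial of `κ[X]`.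
(`c = A_ν` is rational; characteristic `0`: `R = A_{ν-1} / (ν c)`; characteristic `p`, `ν = p^e m` with `p ∤ m`:
`C(ν, p^e(m-1)) = m`, so `R^{p^e} = A_{p^e(m-1)} / (m c)` is rational, and `exists_map_eq_of_pow_eq_map`.)  Consumed by the
descent of contact levels in dimension `≥ 3` (the degree-`b` correction of a contact parameter is a FORM, not a scalar).
[folklore] -/
theorem exists_map_eq_of_binomial_face_polynomial (κ K : Type) [Field κ] [Field K] [Algebra κ K]
    [Algebra.FormallySmooth κ K] [Algebra.EssFiniteType κ K] {ν : ℕ} (hν : 1 ≤ ν) (A : ℕ → κ[X]) {c : K} {R : K[X]}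
    (hc : c ≠ 0) (h : ∀ j ≤ ν, (A j).map (algebraMap κ K) = C c * ((ν.choose j : ℕ) : K[X]) * R ^ (ν - j)) :
    ∃ R₀ : κ[X], R₀.map (algebraMap κ K) = R := by
  -- `c` is rational: `c = (A ν)_0`
  have hAν : (A ν).map (algebraMap κ K) = C c := by
    rw [h ν le_rfl, Nat.choose_self, Nat.sub_self, pow_zero, mul_one]
    simp
  set cκ : κ := (A ν).coeff 0 with hcκdef
  have hcκ : algebraMap κ K cκ = c := by
    have := congrArg (fun P : K[X] => P.coeff 0) hAν
    simp only [coeff_map, coeff_C_zero] at this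
    exact this
  have hcκ0 : cκ ≠ 0 := fun h0 => hc (by rw [← hcκ, h0, map_zero])
  -- the characteristic of `κ`
  obtain ⟨p, hpκ⟩ := CharP.exists κ
  haveI := hpκ
  haveI hpK : CharP K p := charP_of_injective_algebraMap (algebraMap κ K).injective p
  rcases CharP.char_is_prime_or_zero κ p with hprime | hzero
  · -- characteristic `p`: `ν = p^e m`, `p ∤ m`
    haveI := Fact.mk hprime
    haveI : ExpChar K p := ExpChar.prime hprime
    obtain ⟨e, m, hm, hνem⟩ := Nat.exists_eq_pow_mul_and_not_dvd (Nat.one_le_iff_ne_zero.mp hν) p hprime.ne_one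
    have hm1 : 1 ≤ m := Nat.one_le_iff_ne_zero.mpr (by rintro rfl; simp at hνem; omega)
    have hjle : p ^ e * (m - 1) ≤ ν := by rw [hνem]; exact Nat.mul_le_mul_left _ (Nat.sub_le m 1)
    have hsub : ν - p ^ e * (m - 1) = p ^ e := by
      rw [hνem, ← Nat.mul_sub, show m - (m - 1) = 1 by omega, mul_one]
    have hchoose : (((ν.choose (p ^ e * (m - 1))) : ℕ) : K[X]) = C (m : K) := by
      rw [hνem, ← map_natCast C, natCast_choose_pow_mul_pred K p e hm1]
    have hmK : (m : K) ≠ 0 := fun h0 => hm ((CharP.cast_eq_zero_iff K p m).mp h0)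
    have hmκ : (m : κ) ≠ 0 := fun h0 => hm ((CharP.cast_eq_zero_iff κ p m).mp h0)
    -- `R^{p^e} = A_j / (c m)` with `j = p^e (m-1)`
    have hj := h (p ^ e * (m - 1)) hjle
    rw [hsub, hchoose, ← C_mul] at hj
    have hpow : R ^ p ^ e = (C ((cκ * m)⁻¹) * A (p ^ e * (m - 1))).map (algebraMap κ K) := by
      have hcm : algebraMap κ K ((cκ * m)⁻¹) = (c * m)⁻¹ := by
        rw [map_inv₀, (algebraMap κ K).map_mul, hcκ, map_natCast]
      rw [Polynomial.map_mul, map_C, hj, ← mul_assoc, ← C_mul, hcm, inv_mul_cancel₀ (mul_ne_zero hc hmK), C_1, one_mul]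
    exact exists_map_eq_of_pow_eq_map κ K p e hpow
  · -- characteristic `0`: `R = A_{ν-1} / (ν c)`
    subst hzero
    haveI : CharZero κ := CharP.charP_to_charZero κ
    haveI : CharZero K := CharP.charP_to_charZero K
    have hνK : (ν : K) ≠ 0 := by exact_mod_cast (Nat.one_le_iff_ne_zero.mp hν)
    have hj := h (ν - 1) (Nat.sub_le ν 1)
    rw [Nat.sub_sub_self hν, pow_one, Nat.choose_symm_of_eq_add (by omega : ν = (ν - 1) + 1), Nat.choose_one_right,
      ← map_natCast C, ← C_mul] at hj
    refine ⟨C ((cκ * ν)⁻¹) * A (ν - 1), ?_⟩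
    have hcn : algebraMap κ K ((cκ * ν)⁻¹) = (c * ν)⁻¹ := by
      rw [map_inv₀, (algebraMap κ K).map_mul, hcκ, map_natCast]
    rw [Polynomial.map_mul, map_C, hj, ← mul_assoc, ← C_mul, hcn, inv_mul_cancel₀ (mul_ne_zero hc hνK), C_1, one_mul]

end FormallySmoothField

end Summit.ResolutionOfSingularities.ResolutionOfSingularities.Theorems

end
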